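import Literature.MathematicalPhysics.QuantumLattice.HeisenbergStarIntegerSpectrum
import Literature.MathematicalPhysics.QuantumLattice.SpinChainsAkltGroundStateProofs
import Literature.MathematicalPhysics.QuantumLattice.LiebMattisMatrixElements
import HarnessLib

/-!
# Exact dimer (valence-bond) ground states certified by a three-spin inequality:
# the Majumdar–Ghosh chain and the Shastry–Sutherland lattice

Trunk T-QLATTICE; siblings `SpinHalfCasimirBound.lean`, `HeisenbergStarIntegerSpectrum.lean`
(the inputs `𝐋_Y² ⪰ 0`, `𝐋_Y² ⪰ ¾` for `|Y|` odd), `SpinChainsAkltGroundStateProofs.lean`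
(`groundEnergy_eq_of_posSemidef_sub`: a positive shift plus an eigenvector locate the ground
energy) and `HeisenbergChainDimerBound.lean` (the dimer state as a VARIATIONAL state of the
nearest-neighbour ring). Here the dimer (singlet-product, valence-bond) state is an EXACT ground
state, for two frustrated spin-½ antiferromagnets, by one mechanism:

* §1 `posSemidef_triangleOp_add` — **the triangle inequality**: for three distinct spins ½ and
  `0 ≤ b ≤ a`, `a 𝐒_x·𝐒_y + b (𝐒_x·𝐒_z + 𝐒_y·𝐒_z) + ¾a ⪰ 0`, because it equals
  `½(a-b) 𝐋_{xy}² + ½b (𝐋_{xyz}² - ¾)` (`triangleOp_add_eq`) and the total spin of three spins ½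
  is at least `½` (`posSemidef_setSpinSq_sub_of_odd`). This is Majumdar–Ghosh's / Auerbach's
  projection `P_{3/2} = ⅓(𝐉² - ¾) ≥ 0` (Auerbach (1994) eq. (8.16)) and Shastry–Sutherland's
  "each triangle is minimised by the singlet on its strong bond".
* §2 `dimerState` — the product of singlets `∏_{(x,y)∈D} (↑_x↓_y - ↓_x↑_y)` over a set `D` of
  disjoint ordered pairs (`IsDimerSet`); `pairSpin_mulVec_dimerState`: `(𝐒_x + 𝐒_y) ψ_D = 0` for
  every dimer, hence `𝐒_x·𝐒_y ψ_D = -¾ ψ_D` (`spinDot_dimer_mulVec_dimerState`) and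
  `(𝐒_x·𝐒_z + 𝐒_y·𝐒_z) ψ_D = 0` for `z` off the dimer (`spinDot_apex_mulVec_dimerState`; the "odd
  parity of the singlet", Miyahara–Ueda (1999) eq. (4)).
* §3 `triangleSum_isGroundStateVector` — **abstract theorem**: a Hamiltonian that is a sum of
  triangle terms whose strong bonds are dimers of `D`, with `0 ≤ b_t ≤ a_t`, has `ψ_D` as a ground
  state with ground energy `-¾ Σ_t a_t` (frustration-free: every triangle attains its minimum).
* §4 `majumdarGhosh_isGroundStateVector` — the **Majumdar–Ghosh chain**
  `H = J Σ_i (𝐒_i·𝐒_{i+1} + ½ 𝐒_i·𝐒_{i+2})` on the ring `ℤ/Lℤ` (`L` even, `L ≥ 4`, `J ≥ 0`): both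
  dimer coverings `∏ [2n, 2n±1]` are ground states and `E₀ = -3JL/8` (Majumdar–Ghosh (1969);
  Auerbach (1994) §8.2.1, eqs. (8.11)–(8.16)).
* §5 `shastrySutherland_isGroundStateVector` — the **Shastry–Sutherland model** on the torus
  `(ℤ/Lℤ)²` (`L` even, `L ≥ 4`): square-lattice bonds `J'` plus one diagonal dimer bond `J` in every
  second plaquette, orthogonally staggered so that the dimers cover every site once; for
  `0 ≤ J' ≤ J/2` the dimer-singlet product is a ground state with `E₀ = -(3J/8)·L²` (`-¾J` per
  dimer) (Shastry–Sutherland (1981); Oitmaa–Hamer–Zheng (2006) §5.4.2: "an exact eigenstate for all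
  `J, J'` and the ground state at least for `J/J' > 2`"; Miyahara–Ueda (1999)).

* §6 complements: the dimer states are eigenvectors for ALL couplings
  (`mgHamiltonian_mulVec_dimerState`, `ssHamiltonian_mulVec_dimerState` — Oitmaa–Hamer–Zheng's "exact
  eigenstate for all `J, J'`"); the second triangle inequality `h ⪰ a/4 - b` for `a ≤ b`
  (`posSemidef_triangleOp_add_of_le`); and the resulting Anderson-type certified floors on the
  ground-state energy of the frustrated `J₁–J₂` ring (`j1j2Ring_groundEnergy_ge_of_le`,
  `j1j2Ring_groundEnergy_ge_of_ge`: `E₀/L ≥ -¾J₂` for `J₂ ≥ J₁/2`, `E₀/L ≥ -(J₁/2 - J₂/4)` for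
  `J₂ ≤ J₁/2`, both sharp at the Majumdar–Ghosh point).

Scope: the statements are the finite-volume theorems as printed (periodic boundary conditions);
uniqueness / the size of the ground-state degeneracy and the extension of the Shastry–Sutherland
dimer phase beyond `J'/J = ½` (numerically to `≈ 0.675`) are NOT claimed. No `sorry`, no new
axiom; definitions (all with bodies): `triangleOp`, `singletAmp`, `IsDimerSet`, `dimerState`,
`refConfig`, `triangleSum`, `mgHamiltonian`, `ringParity`, `mgDimers`, `mgDim`, `mgApex`,
`ssParity`, `ssBlack`, `ssDimer`, `ssApex`, `ssDimers`, `ssPlaquette`, `ssHamiltonian`, `ssBase`,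
`j1j2Ring`;
no named facts (`def … : Prop`), no instances, no notation.

## References

* [MajumdarGhosh1969] C. K. Majumdar, D. K. Ghosh, *On next-nearest-neighbor interaction in linear
  chain. I*, J. Math. Phys. 10 (1969) 1388–1398.
* [Auerbach1994] A. Auerbach, *Interacting Electrons and Quantum Magnetism*, Springer (1994),
  §8.2.1 "The Majumdar–Ghosh Hamiltonian", eqs. (8.11)–(8.16), pp. 83–85.
* [ShastrySutherland1981] B. S. Shastry, B. Sutherland, *Exact ground state of a quantum mechanical
  antiferromagnet*, Physica B+C 108 (1981) 1069–1070.
* [MiyaharaUeda1999] S. Miyahara, K. Ueda, *Exact dimer ground state of the two dimensional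
  Heisenberg spin system SrCu₂(BO₃)₂*, Phys. Rev. Lett. 82 (1999) 3701 (cond-mat/9807075), eqs.
  (1)–(4).
* [OitmaaHamerZheng2006] J. Oitmaa, C. Hamer, W. Zheng, *Series Expansion Methods for Strongly
  Interacting Lattice Models*, CUP (2006), §5.4.2 "The SCBO system", p. 108.
* [Tasaki2020] H. Tasaki, *Physics and Mathematics of Quantum Many-Body Systems*, Springer (2020),
  §2.2, §2.4, App. A.3.
* [Anderson1951] P. W. Anderson, *Limits on the energy of the antiferromagnetic ground state*,
  Phys. Rev. 83 (1951) 1260, eq. (4) (cluster lower bounds).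
-/

noncomputable section

open Matrix Complex Finset
open scoped ComplexOrder

namespace Literature.MathematicalPhysics.QuantumLattice

open SpinOperators

namespace ExactDimer

variable {Λ : Type*} [Fintype Λ] [DecidableEq Λ]

/-! ## §1 The triangle inequality for three spins ½ -/

/-- `𝐋_{{y}}² = Σ_α (Sᵅ_y)² = ¾` for one spin ½. [cite: Tasaki2020, §2.1 eq. (2.1.8)] -/
theorem setSpinSq_singleton (y : Λ) :
    (∑ α : Fin 3, (∑ w ∈ ({y} : Finset Λ), siteSpin 1 w α) *
        (∑ w ∈ ({y} : Finset Λ), siteSpin 1 w α) : Op Λ 2) = (3 / 4 : ℂ) • 1 := by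
  simp only [Finset.sum_singleton, siteSpin_one_mul_self, Fin.sum_univ_three, ← add_smul]
  norm_num

/-- `𝐋_{{x,y}}² = 3/2 + 2 𝐒_x·𝐒_y` for two distinct spins ½ (Auerbach (1994) eq. (8.16) for a
pair). [cite: Auerbach1994, §8.2.1 eq. (8.16)] -/
theorem setSpinSq_pair {x y : Λ} (hxy : x ≠ y) :
    (∑ α : Fin 3, (∑ w ∈ ({x, y} : Finset Λ), siteSpin 1 w α) *
        (∑ w ∈ ({x, y} : Finset Λ), siteSpin 1 w α) : Op Λ 2) =
      (3 / 2 : ℂ) • 1 + (2 : ℂ) • spinDot 1 x y := by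
  have hx : x ∉ ({y} : Finset Λ) := by simpa using hxy
  rw [setSpinSq_insert hx, setSpinSq_singleton, Finset.sum_singleton]
  module

/-- `𝐉² = 𝐋_{{z,x,y}}² = 9/4 + 2(𝐒_x·𝐒_y + 𝐒_x·𝐒_z + 𝐒_y·𝐒_z)` for three distinct spins ½
(Auerbach (1994) eq. (8.16): `P_{3/2} = ⅓(𝐉² - ¾) = ½ + ⅔ Σ 𝐒·𝐒`).
[cite: Auerbach1994, §8.2.1 eq. (8.16)] -/
theorem setSpinSq_triple {x y z : Λ} (hxy : x ≠ y) (hxz : x ≠ z) (hyz : y ≠ z) :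
    (∑ α : Fin 3, (∑ w ∈ ({z, x, y} : Finset Λ), siteSpin 1 w α) *
        (∑ w ∈ ({z, x, y} : Finset Λ), siteSpin 1 w α) : Op Λ 2) =
      (9 / 4 : ℂ) • 1 + (2 : ℂ) • (spinDot 1 x y + spinDot 1 x z + spinDot 1 y z) := by
  have hz : z ∉ ({x, y} : Finset Λ) := by simp [hxz.symm, hyz.symm]
  rw [setSpinSq_insert hz, setSpinSq_pair hxy, Finset.sum_pair hxy, spinDot_comm 1 x z,
    spinDot_comm 1 y z]
  module

/-- The **triangle operator** `h(a,b; x,y | z) = a 𝐒_x·𝐒_y + b (𝐒_x·𝐒_z + 𝐒_y·𝐒_z)`: a "strong"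
bond `{x,y}` of strength `a` and the two bonds of strength `b` joining it to the apex `z`
(Shastry–Sutherland's triangles; for `a = b` it is `½(𝐉² - 9/4)`, Auerbach (1994) eq. (8.16)).
[cite: Auerbach1994, §8.2.1 eqs. (8.15)–(8.16)] -/
def triangleOp (a b : ℝ) (x y z : Λ) : Op Λ 2 :=
  (a : ℂ) • spinDot 1 x y + (b : ℂ) • (spinDot 1 x z + spinDot 1 y z)

/-- **The triangle operator as a combination of total-spin squares**:
`h(a,b) + ¾a = ½(a-b) 𝐋_{xy}² + ½b (𝐋_{xyz}² - ¾)`. [cite: Auerbach1994, §8.2.1 eqs. (8.15)–(8.16)] -/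
theorem triangleOp_add_eq (a b : ℝ) {x y z : Λ} (hxy : x ≠ y) (hxz : x ≠ z) (hyz : y ≠ z) :
    triangleOp a b x y z + ((3 * a / 4 : ℝ) : ℂ) • (1 : Op Λ 2) =
      (((a - b) / 2 : ℝ) : ℂ) • (∑ α : Fin 3, (∑ w ∈ ({x, y} : Finset Λ), siteSpin 1 w α) *
          (∑ w ∈ ({x, y} : Finset Λ), siteSpin 1 w α) : Op Λ 2) +
      ((b / 2 : ℝ) : ℂ) • ((∑ α : Fin 3, (∑ w ∈ ({z, x, y} : Finset Λ), siteSpin 1 w α) *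
          (∑ w ∈ ({z, x, y} : Finset Λ), siteSpin 1 w α) : Op Λ 2) - (3 / 4 : ℂ) • (1 : Op Λ 2)) := by
  rw [setSpinSq_pair hxy, setSpinSq_triple hxy hxz hyz, triangleOp]
  push_cast
  module

/-- **The triangle inequality** (three distinct spins ½, `0 ≤ b ≤ a`):
`a 𝐒_x·𝐒_y + b (𝐒_x·𝐒_z + 𝐒_y·𝐒_z) ⪰ -¾a`, i.e. the triangle term is minimised by the singlet on
its strong bond: `½(a-b) 𝐋_{xy}² ⪰ 0` and `½b(𝐉² - ¾) = (3b/2) P_{3/2} ⪰ 0` (the total spin of three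
spins ½ is `½` or `3/2`). Majumdar–Ghosh / Auerbach (1994) eqs. (8.15)–(8.16) (`a = b`);
Shastry–Sutherland (1981) (`b ≤ a`). [cite: Auerbach1994, §8.2.1 eqs. (8.15)–(8.16)] -/
theorem posSemidef_triangleOp_add [Nonempty Λ] {a b : ℝ} (hb : 0 ≤ b) (hab : b ≤ a) {x y z : Λ}
    (hxy : x ≠ y) (hxz : x ≠ z) (hyz : y ≠ z) :
    (triangleOp a b x y z + ((3 * a / 4 : ℝ) : ℂ) • (1 : Op Λ 2)).PosSemidef := by
  rw [triangleOp_add_eq a b hxy hxz hyz]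
  have hz : z ∉ ({x, y} : Finset Λ) := by simp [hxz.symm, hyz.symm]
  have hcard : ({z, x, y} : Finset Λ).card % 2 = 1 := by
    rw [Finset.card_insert_of_notMem hz, Finset.card_pair hxy]
  refine PosSemidef.add ?_ ?_
  · exact (posSemidef_setSpinSq _).smul (by exact_mod_cast (by linarith : (0 : ℝ) ≤ (a - b) / 2))
  · exact (posSemidef_setSpinSq_sub_of_odd _ hcard).smul
      (by exact_mod_cast (by linarith : (0 : ℝ) ≤ b / 2))

/-! ## §2 Dimer (singlet-product) states -/

/-- The singlet amplitude on an ordered pair of spins ½ (`0 = ↑`, `1 = ↓`):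
`s(↑,↓) = 1`, `s(↓,↑) = -1`, `s(↑,↑) = s(↓,↓) = 0`, i.e. `|s⟩ = |↑↓⟩ - |↓↑⟩` (unnormalised).
[cite: MiyaharaUeda1999, eq. (2)] -/
def singletAmp (k l : Fin 2) : ℂ :=
  if k = 0 ∧ l = 1 then 1 else if k = 1 ∧ l = 0 then -1 else 0

/-- A **dimer set**: a finite set of ordered pairs of sites which are loop-free and pairwise
disjoint (a partial matching of the sites, each dimer carrying an orientation).
[cite: Auerbach1994, §8.2 eq. (8.12)] -/
structure IsDimerSet (D : Finset (Λ × Λ)) : Prop where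
  loopFree : ∀ d ∈ D, d.1 ≠ d.2
  disjoint : ∀ d ∈ D, ∀ d' ∈ D, d ≠ d' → d.1 ≠ d'.1 ∧ d.1 ≠ d'.2 ∧ d.2 ≠ d'.1 ∧ d.2 ≠ d'.2

/-- The **dimer state** (valence-bond / singlet-product state) of a dimer set `D`:
`ψ_D(σ) = ∏_{(x,y)∈D} s(σ_x, σ_y)`, i.e. `⊗_{(x,y)∈D} (|↑_x↓_y⟩ - |↓_x↑_y⟩)` (times the
unconstrained vector on uncovered sites). Auerbach (1994) eq. (8.12); Miyahara–Ueda (1999) eq. (3).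
[cite: Auerbach1994, §8.2.1 eq. (8.12)] -/
def dimerState (D : Finset (Λ × Λ)) : TensorIndex Λ 2 → ℂ :=
  fun σ => ∏ d ∈ D, singletAmp (σ d.1) (σ d.2)

variable {D : Finset (Λ × Λ)}

omit [Fintype Λ] in
/-- Splitting off one dimer factor. [cite: Auerbach1994, §8.2.1 eq. (8.12)] -/
theorem dimerState_eq_mul {d₀ : Λ × Λ} (hd : d₀ ∈ D) (σ : TensorIndex Λ 2) :
    dimerState D σ = singletAmp (σ d₀.1) (σ d₀.2) * ∏ d ∈ D.erase d₀, singletAmp (σ d.1) (σ d.2) := by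
  rw [dimerState, ← Finset.mul_prod_erase D _ hd]

omit [Fintype Λ] in
/-- Flipping a spin of the dimer `d₀` only changes the factor of `d₀`.
[cite: Auerbach1994, §8.2.1 eq. (8.12)] -/
theorem dimerState_update (hD : IsDimerSet D) {d₀ : Λ × Λ} (hd : d₀ ∈ D) {x : Λ}
    (hx : x = d₀.1 ∨ x = d₀.2) (σ : TensorIndex Λ 2) (l : Fin 2) :
    dimerState D (Function.update σ x l) =
      singletAmp (Function.update σ x l d₀.1) (Function.update σ x l d₀.2) *
        ∏ d ∈ D.erase d₀, singletAmp (σ d.1) (σ d.2) := by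
  rw [dimerState_eq_mul hd]
  congr 1
  refine Finset.prod_congr rfl fun d hd' => ?_
  obtain ⟨hne, hdD⟩ := Finset.mem_erase.mp hd'
  obtain ⟨h11, h12, h21, h22⟩ := hD.disjoint d₀ hd d hdD (Ne.symm hne)
  have h1 : d.1 ≠ x := by
    rcases hx with rfl | rfl
    exacts [h11.symm, h21.symm]
  have h2 : d.2 ≠ x := by
    rcases hx with rfl | rfl
    exacts [h12.symm, h22.symm]
  rw [Function.update_of_ne h1, Function.update_of_ne h2]

/-- The Pauli-matrix identity behind the rotation invariance of the singlet:
`Σ_l (Sᵅ_{kl} s(l,m) + Sᵅ_{ml} s(k,l)) = 0`, i.e. `(Sᵅ ⊗ 1 + 1 ⊗ Sᵅ)|s⟩ = 0`.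
[cite: Tasaki2020, §2.1 eq. (2.1.8), App. A.3] -/
theorem sum_spinVec_singletAmp (α : Fin 3) (k m : Fin 2) :
    ∑ l : Fin 2, (spinVec 1 α k l * singletAmp l m + spinVec 1 α m l * singletAmp k l) = 0 := by
  rw [spinVec_one_eq_half_spinHalfPauli]
  fin_cases α <;> fin_cases k <;> fin_cases m <;>
    simp [Fin.sum_univ_two, spinHalfPauli, singletAmp]

/-- **Each dimer is a singlet**: `(Sᵅ_x + Sᵅ_y) ψ_D = 0` for every dimer `(x,y) ∈ D` and every
component `α`. Auerbach (1994) §8.2.1 (the triad argument); Miyahara–Ueda (1999) eq. (4).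
[cite: Auerbach1994, §8.2.1] -/
theorem pairSpin_mulVec_dimerState (hD : IsDimerSet D) {d₀ : Λ × Λ} (hd : d₀ ∈ D) (α : Fin 3) :
    (siteSpin 1 d₀.1 α + siteSpin 1 d₀.2 α : Op Λ 2) *ᵥ dimerState D = 0 := by
  have hne := hD.loopFree d₀ hd
  funext σ
  rw [add_mulVec, Pi.add_apply, Pi.zero_apply, siteSpin, siteSpin, LiebMattis.onSite_mulVec_apply,
    LiebMattis.onSite_mulVec_apply]
  set R : ℂ := ∏ d ∈ D.erase d₀, singletAmp (σ d.1) (σ d.2) with hR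
  have hx : ∀ l : Fin 2, dimerState D (Function.update σ d₀.1 l) = singletAmp l (σ d₀.2) * R := by
    intro l
    rw [dimerState_update hD hd (Or.inl rfl), Function.update_self, Function.update_of_ne hne.symm]
  have hy : ∀ l : Fin 2, dimerState D (Function.update σ d₀.2 l) = singletAmp (σ d₀.1) l * R := by
    intro l
    rw [dimerState_update hD hd (Or.inr rfl), Function.update_self, Function.update_of_ne hne]
  simp_rw [hx, hy]
  calc ∑ l : Fin 2, spinVec 1 α (σ d₀.1) l * (singletAmp l (σ d₀.2) * R) +
        ∑ l : Fin 2, spinVec 1 α (σ d₀.2) l * (singletAmp (σ d₀.1) l * R)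
      = (∑ l : Fin 2, (spinVec 1 α (σ d₀.1) l * singletAmp l (σ d₀.2) +
          spinVec 1 α (σ d₀.2) l * singletAmp (σ d₀.1) l)) * R := by
        rw [Finset.sum_mul, ← Finset.sum_add_distrib]
        exact Finset.sum_congr rfl fun l _ => by ring
    _ = 0 := by rw [sum_spinVec_singletAmp, zero_mul]

/-- **The strong bond sees a singlet**: `𝐒_x·𝐒_y ψ_D = -¾ ψ_D` for `(x,y) ∈ D`
(`Sᵅ_y ψ = -Sᵅ_x ψ` and `(Sᵅ_x)² = ¼`). [cite: Auerbach1994, §8.2.1 eq. (8.13)] -/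
theorem spinDot_dimer_mulVec_dimerState (hD : IsDimerSet D) {d₀ : Λ × Λ} (hd : d₀ ∈ D) :
    (spinDot 1 d₀.1 d₀.2 : Op Λ 2) *ᵥ dimerState D = (-(3 / 4 : ℂ)) • dimerState D := by
  have hne := hD.loopFree d₀ hd
  have hα : ∀ α : Fin 3, (siteSpin 1 d₀.1 α * siteSpin 1 d₀.2 α : Op Λ 2) *ᵥ dimerState D =
      (-(1 / 4 : ℂ)) • dimerState D := by
    intro α
    have h := pairSpin_mulVec_dimerState hD hd α
    rw [add_mulVec] at h
    have h2 : (siteSpin 1 d₀.2 α : Op Λ 2) *ᵥ dimerState D = -((siteSpin 1 d₀.1 α : Op Λ 2) *ᵥ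
        dimerState D) := eq_neg_of_add_eq_zero_right h
    rw [← mulVec_mulVec, h2, mulVec_neg, mulVec_mulVec, siteSpin_one_mul_self, smul_mulVec,
      one_mulVec, neg_smul]
  rw [spinDot_eq_sum_mul_of_ne 1 hne, Matrix.sum_mulVec, Finset.sum_congr rfl fun α _ => hα α,
    Finset.sum_const, Finset.card_univ, Fintype.card_fin, ← Nat.cast_smul_eq_nsmul ℂ, smul_smul]
  norm_num

/-- **The weak bonds of a triangle cancel on the singlet** ("odd parity of the singlet"):
`(𝐒_x·𝐒_z + 𝐒_y·𝐒_z) ψ_D = Σ_α Sᵅ_z (Sᵅ_x + Sᵅ_y) ψ_D = 0` for `(x,y) ∈ D` and `z ∉ {x,y}`.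
Miyahara–Ueda (1999) eq. (4); Auerbach (1994) §8.2.1. [cite: MiyaharaUeda1999, eq. (4)] -/
theorem spinDot_apex_mulVec_dimerState (hD : IsDimerSet D) {d₀ : Λ × Λ} (hd : d₀ ∈ D) {z : Λ}
    (hz1 : z ≠ d₀.1) (hz2 : z ≠ d₀.2) :
    (spinDot 1 d₀.1 z + spinDot 1 d₀.2 z : Op Λ 2) *ᵥ dimerState D = 0 := by
  rw [spinDot_eq_sum_mul_of_ne 1 hz1.symm, spinDot_eq_sum_mul_of_ne 1 hz2.symm,
    ← Finset.sum_add_distrib, Matrix.sum_mulVec]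
  refine Finset.sum_eq_zero fun α _ => ?_
  rw [(siteSpin_commute_of_ne_holds 1 hz1.symm α α).eq, (siteSpin_commute_of_ne_holds 1 hz2.symm α α).eq,
    ← Matrix.mul_add, ← mulVec_mulVec, pairSpin_mulVec_dimerState hD hd α, mulVec_zero]

/-- The reference configuration `σ_D`: `↓` on the second site of every dimer, `↑` elsewhere.
[cite: Auerbach1994, §8.2.1 eq. (8.12)] -/
def refConfig (D : Finset (Λ × Λ)) : TensorIndex Λ 2 :=
  fun w => if ∃ d ∈ D, w = d.2 then 1 else 0

omit [Fintype Λ] in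
/-- On the reference configuration every dimer reads `(↑,↓)`. [cite: Auerbach1994, §8.2.1 eq. (8.12)] -/
theorem refConfig_dimer (hD : IsDimerSet D) {d : Λ × Λ} (hd : d ∈ D) :
    refConfig D d.1 = 0 ∧ refConfig D d.2 = 1 := by
  constructor
  · rw [refConfig, if_neg]
    rintro ⟨d', hd', h⟩
    by_cases hdd : d = d'
    · exact hD.loopFree d hd (hdd ▸ h)
    · exact (hD.disjoint d hd d' hd' hdd).2.1 h
  · rw [refConfig, if_pos ⟨d, hd, rfl⟩]

omit [Fintype Λ] in
/-- **The dimer state is nonzero**: `ψ_D(σ_D) = 1`. [cite: Auerbach1994, §8.2.1 eq. (8.12)] -/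
theorem dimerState_refConfig (hD : IsDimerSet D) : dimerState D (refConfig D) = 1 := by
  rw [dimerState]
  refine Finset.prod_eq_one fun d hd => ?_
  obtain ⟨h1, h2⟩ := refConfig_dimer hD hd
  simp [singletAmp, h1, h2]

omit [Fintype Λ] in
/-- The dimer state is not the zero vector. [cite: Auerbach1994, §8.2.1 eq. (8.12)] -/
theorem dimerState_ne_zero (hD : IsDimerSet D) : dimerState D ≠ 0 := by
  intro h
  have h1 := dimerState_refConfig hD
  rw [h, Pi.zero_apply] at h1
  exact zero_ne_one h1

/-! ## §3 Triangle-sum Hamiltonians are frustration-free on the dimer state -/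

variable {ι : Type*}

/-- A **triangle-sum Hamiltonian** `H = Σ_{t∈T} [a_t 𝐒_{x_t}·𝐒_{y_t} + b_t(𝐒_{x_t}·𝐒_{z_t} +
𝐒_{y_t}·𝐒_{z_t})]` with strong bonds `dim t = (x_t, y_t)` and apexes `apex t = z_t`.
[cite: Auerbach1994, §8.2.1 eq. (8.15)] -/
def triangleSum (T : Finset ι) (dim : ι → Λ × Λ) (apex : ι → Λ) (a b : ι → ℝ) : Op Λ 2 :=
  ∑ t ∈ T, triangleOp (a t) (b t) (dim t).1 (dim t).2 (apex t)

variable {T : Finset ι} {dim : ι → Λ × Λ} {apex : ι → Λ} {a b : ι → ℝ}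

/-- **Every triangle attains its minimum on the dimer state**:
`h_t ψ_D = -¾a_t ψ_D`, hence `H ψ_D = -(¾ Σ_t a_t) ψ_D`. [cite: Auerbach1994, §8.2.1 eq. (8.13)] -/
theorem triangleSum_mulVec_dimerState (hD : IsDimerSet D) (hdim : ∀ t ∈ T, dim t ∈ D)
    (hapex : ∀ t ∈ T, apex t ≠ (dim t).1 ∧ apex t ≠ (dim t).2) :
    triangleSum T dim apex a b *ᵥ dimerState D =
      ((-(3 / 4 * ∑ t ∈ T, a t) : ℝ) : ℂ) • dimerState D := by
  rw [triangleSum, Matrix.sum_mulVec]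
  have ht : ∀ t ∈ T, triangleOp (a t) (b t) (dim t).1 (dim t).2 (apex t) *ᵥ dimerState D =
      ((-(3 / 4 * a t) : ℝ) : ℂ) • dimerState D := by
    intro t htT
    rw [triangleOp, add_mulVec, smul_mulVec, smul_mulVec,
      spinDot_dimer_mulVec_dimerState hD (hdim t htT),
      spinDot_apex_mulVec_dimerState hD (hdim t htT) (hapex t htT).1 (hapex t htT).2, smul_zero,
      add_zero, smul_smul]
    push_cast
    ring_nf
  rw [Finset.sum_congr rfl ht, ← Finset.sum_smul]
  congr 1
  push_cast
  rw [Finset.mul_sum, ← Finset.sum_neg_distrib]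

/-- **The shifted triangle sum is positive**: `H + ¾ Σ_t a_t = Σ_t (h_t + ¾a_t) ⪰ 0` when
`0 ≤ b_t ≤ a_t` on every triangle. [cite: Auerbach1994, §8.2.1 eqs. (8.15)–(8.16)] -/
theorem posSemidef_triangleSum_add [Nonempty Λ] (hD : IsDimerSet D) (hdim : ∀ t ∈ T, dim t ∈ D)
    (hapex : ∀ t ∈ T, apex t ≠ (dim t).1 ∧ apex t ≠ (dim t).2)
    (hab : ∀ t ∈ T, 0 ≤ b t ∧ b t ≤ a t) :
    (triangleSum T dim apex a b + ((3 / 4 * ∑ t ∈ T, a t : ℝ) : ℂ) • (1 : Op Λ 2)).PosSemidef := by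
  have hsplit : triangleSum T dim apex a b + ((3 / 4 * ∑ t ∈ T, a t : ℝ) : ℂ) • (1 : Op Λ 2) =
      ∑ t ∈ T, (triangleOp (a t) (b t) (dim t).1 (dim t).2 (apex t) +
        ((3 * a t / 4 : ℝ) : ℂ) • (1 : Op Λ 2)) := by
    rw [Finset.sum_add_distrib, ← triangleSum, ← Finset.sum_smul]
    congr 2
    push_cast
    rw [Finset.mul_sum]
    exact Finset.sum_congr rfl fun t _ => by ring
  rw [hsplit]
  refine posSemidef_finset_sum T fun t htT => ?_
  have hne := hD.loopFree (dim t) (hdim t htT)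
  exact posSemidef_triangleOp_add (hab t htT).1 (hab t htT).2 hne (hapex t htT).1.symm
    (hapex t htT).2.symm

/-- A triangle sum is Hermitian. [cite: Tasaki2020, §2.4] -/
theorem triangleSum_isHermitian : (triangleSum T dim apex a b : Op Λ 2).IsHermitian := by
  unfold triangleSum triangleOp
  rw [IsHermitian, conjTranspose_sum]
  refine Finset.sum_congr rfl fun t _ => ?_
  rw [conjTranspose_add, conjTranspose_smul, conjTranspose_smul, conjTranspose_add,
    (spinDot_isHermitian 1 _ _).eq, (spinDot_isHermitian 1 _ _).eq, (spinDot_isHermitian 1 _ _).eq]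
  simp only [Complex.star_def, Complex.conj_ofReal]

/-- **Abstract Majumdar–Ghosh / Shastry–Sutherland theorem.** If every strong bond of a
triangle-sum Hamiltonian is a dimer of `D`, its apex is off that dimer, and `0 ≤ b_t ≤ a_t`, then
the dimer state `ψ_D` is a ground state and the ground energy is `-¾ Σ_t a_t` (each triangle
contributes its singlet energy; frustration-free). Auerbach (1994) §8.2.1 ("`H^{MG}` is a sum of
projection operators … annihilates any state with total spin ½ of the triad");
Shastry–Sutherland (1981). [cite: Auerbach1994, §8.2.1 eqs. (8.13)–(8.16)] -/
theorem triangleSum_isGroundStateVector [Nonempty Λ] (hD : IsDimerSet D)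
    (hdim : ∀ t ∈ T, dim t ∈ D) (hapex : ∀ t ∈ T, apex t ≠ (dim t).1 ∧ apex t ≠ (dim t).2)
    (hab : ∀ t ∈ T, 0 ≤ b t ∧ b t ≤ a t) :
    (triangleSum T dim apex a b).IsGroundStateVector (dimerState D) ∧
      (triangleSum T dim apex a b).groundEnergy = -(3 / 4 * ∑ t ∈ T, a t) := by
  have hmul := triangleSum_mulVec_dimerState (a := a) (b := b) hD hdim hapex
  have hE : (triangleSum T dim apex a b).groundEnergy = -(3 / 4 * ∑ t ∈ T, a t) := by
    refine groundEnergy_eq_of_posSemidef_sub triangleSum_isHermitian _ ?_ (dimerState_ne_zero hD) hmul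
    rw [Algebra.algebraMap_eq_smul_one, ← Complex.coe_smul, sub_eq_add_neg, ← neg_smul,
      Complex.ofReal_neg, neg_neg]
    exact posSemidef_triangleSum_add hD hdim hapex hab
  refine ⟨⟨dimerState_ne_zero hD, ?_⟩, hE⟩
  rw [hE, hmul]

/-! ## §4 The Majumdar–Ghosh chain -/

section MajumdarGhosh

variable (L : ℕ) [NeZero L]

/-- The **Majumdar–Ghosh Hamiltonian** on the ring `ℤ/Lℤ` (spin ½):
`H = Σ_i (J 𝐒_i·𝐒_{i+1} + ½J 𝐒_i·𝐒_{i+2})` — Auerbach (1994) eq. (8.11) without the overall factor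
`4|K|/3` and the additive constant. [cite: Auerbach1994, §8.2.1 eq. (8.11)] -/
def mgHamiltonian (J : ℝ) : Op (ZMod L) 2 :=
  ∑ i : ZMod L, ((J : ℂ) • spinDot 1 i (i + 1) + ((J / 2 : ℝ) : ℂ) • spinDot 1 i (i + 2))

/-- Dictionary: `H_MG = J · heisenbergRing + ½J Σ_i 𝐒_i·𝐒_{i+2}` (the tree's nearest-neighbour ring
plus the next-nearest-neighbour bonds). [cite: Auerbach1994, §8.2.1 eq. (8.11)] -/
theorem mgHamiltonian_eq (J : ℝ) :
    mgHamiltonian L J = (J : ℂ) • heisenbergRing L 1 +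
      ((J / 2 : ℝ) : ℂ) • ∑ i : ZMod L, (spinDot 1 i (i + 2) : Op (ZMod L) 2) := by
  rw [mgHamiltonian, heisenbergRing, Finset.sum_add_distrib, Finset.smul_sum, Finset.smul_sum]

/-- The parity of a site of the even ring, `i mod 2`. [cite: Auerbach1994, §8.2.1 eq. (8.12)] -/
def ringParity (i : ZMod L) : ZMod 2 := (ZMod.cast i : ZMod 2)

/-- The two **dimer coverings** of the even ring: `D_c = {(i, i+1) : i ≡ c (mod 2)}`, `c = 0, 1`
(Auerbach's `|d⟩_±`, eq. (8.12)). [cite: Auerbach1994, §8.2.1 eq. (8.12)] -/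
def mgDimers (c : ZMod 2) : Finset (ZMod L × ZMod L) :=
  (Finset.univ.filter fun i : ZMod L => ringParity L i = c).image fun i => (i, i + 1)

/-- The strong bond of the triad `(i, i+1, i+2)`: the dimer of `D_c` inside it.
[cite: Auerbach1994, §8.2.1 eqs. (8.14)–(8.15)] -/
def mgDim (c : ZMod 2) (i : ZMod L) : ZMod L × ZMod L :=
  if ringParity L i = c then (i, i + 1) else (i + 1, i + 2)

/-- The apex of the triad `(i, i+1, i+2)`: its site not on the dimer of `D_c`.
[cite: Auerbach1994, §8.2.1 eqs. (8.14)–(8.15)] -/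
def mgApex (c : ZMod 2) (i : ZMod L) : ZMod L :=
  if ringParity L i = c then i + 2 else i

variable {L}

omit [NeZero L] in
/-- On an even ring the parity is additive: `parity (i + 1) = parity i + 1`. [folklore] -/
private theorem ringParity_add_one (h2 : 2 ∣ L) (i : ZMod L) :
    ringParity L (i + 1) = ringParity L i + 1 := by
  have h := map_add (ZMod.castHom h2 (ZMod 2)) i 1
  rw [map_one] at h
  simpa [ringParity] using h

/-- `1 ≠ 0` in `ℤ/Lℤ` for even `L ≠ 0`. [folklore] -/
private theorem one_ne_zero_of_even (h2 : 2 ∣ L) : (1 : ZMod L) ≠ 0 := by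
  obtain ⟨k, hk⟩ := h2
  have hL : L ≠ 0 := NeZero.ne L
  haveI : Fact (1 < L) := ⟨by omega⟩
  exact one_ne_zero

omit [NeZero L] in
/-- `2 ≠ 0` in `ℤ/Lℤ` for `L ≥ 3`. [folklore] -/
private theorem two_ne_zero_of_le (hL : 3 ≤ L) : (2 : ZMod L) ≠ 0 := by
  intro h
  have h' : ((2 : ℕ) : ZMod L) = 0 := by exact_mod_cast h
  rw [ZMod.natCast_eq_zero_iff] at h'
  have := Nat.le_of_dvd (by norm_num) h'
  omega

/-- In `ℤ/2ℤ`, `u + 1 ≠ u`. [folklore] -/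
private theorem zmod2_add_one_ne : ∀ u : ZMod 2, u + 1 ≠ u := by decide

/-- In `ℤ/2ℤ`, `u ≠ c` forces `u + 1 = c`. [folklore] -/
private theorem zmod2_add_one_eq_of_ne : ∀ {u c : ZMod 2}, u ≠ c → u + 1 = c := by decide

/-- **The dimer coverings of the even ring are dimer sets.** [cite: Auerbach1994, §8.2.1 eq. (8.12)] -/
theorem isDimerSet_mgDimers (h2 : 2 ∣ L) (c : ZMod 2) : IsDimerSet (mgDimers L c) := by
  have h1 := one_ne_zero_of_even h2
  constructor
  · intro d hd
    obtain ⟨i, -, rfl⟩ := Finset.mem_image.mp hd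
    intro h
    exact h1 (by simpa using h.symm)
  · intro d hd d' hd' hne
    obtain ⟨i, hi, rfl⟩ := Finset.mem_image.mp hd
    obtain ⟨i', hi', rfl⟩ := Finset.mem_image.mp hd'
    simp only [Finset.mem_filter, Finset.mem_univ, true_and] at hi hi'
    have hii : i ≠ i' := fun h => hne (by rw [h])
    refine ⟨hii, ?_, ?_, fun h => hii (add_right_cancel h)⟩
    · intro h
      have hp := congrArg (ringParity L) h
      rw [ringParity_add_one h2, hi, hi'] at hp
      exact zmod2_add_one_ne c hp.symm
    · intro h
      have hp := congrArg (ringParity L) h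
      rw [ringParity_add_one h2, hi, hi'] at hp
      exact zmod2_add_one_ne c hp

/-- Every triad contains a dimer of `D_c`. [cite: Auerbach1994, §8.2.1] -/
theorem mgDim_mem (h2 : 2 ∣ L) (c : ZMod 2) (i : ZMod L) : mgDim L c i ∈ mgDimers L c := by
  unfold mgDim mgDimers
  split_ifs with h
  · exact Finset.mem_image_of_mem _ (by simpa using h)
  · have h' : ringParity L (i + 1) = c := by
      rw [ringParity_add_one h2]
      exact zmod2_add_one_eq_of_ne h
    have he : (i + 1, i + 2) = (fun j : ZMod L => (j, j + 1)) (i + 1) := by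
      simp only [Prod.mk.injEq, true_and]
      ring
    rw [he]
    exact Finset.mem_image_of_mem _ (by simpa using h')

/-- The apex of a triad is off its dimer (`L ≥ 3`). [cite: Auerbach1994, §8.2.1] -/
theorem mgApex_ne (h2 : 2 ∣ L) (hL : 3 ≤ L) (c : ZMod 2) (i : ZMod L) :
    mgApex L c i ≠ (mgDim L c i).1 ∧ mgApex L c i ≠ (mgDim L c i).2 := by
  have h1 := one_ne_zero_of_even h2
  have h2' := two_ne_zero_of_le hL
  unfold mgApex mgDim
  split_ifs with h
  · refine ⟨fun e => h2' (by simpa using e), fun e => h1 ?_⟩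
    have : i + 2 = i + 1 + 1 := by ring
    rw [this] at e
    simpa using e
  · exact ⟨fun e => h1 (by simpa using e.symm), fun e => h2' (by simpa using e.symm)⟩

/-- **The Majumdar–Ghosh Hamiltonian is a triangle sum**:
`H_MG = Σ_i ½J (𝐒_i·𝐒_{i+1} + 𝐒_i·𝐒_{i+2} + 𝐒_{i+1}·𝐒_{i+2}) = ½J Σ_i (𝐉_i² - 9/4)/… `, each
nearest-neighbour bond lying in two triads and each next-nearest one in one (Auerbach (1994)
eqs. (8.15)–(8.16)). [cite: Auerbach1994, §8.2.1 eqs. (8.15)–(8.16)] -/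
theorem mg_triangleSum_eq (c : ZMod 2) (J : ℝ) :
    triangleSum Finset.univ (mgDim L c) (mgApex L c) (fun _ => J / 2) (fun _ => J / 2) =
      mgHamiltonian L J := by
  have hterm : ∀ i : ZMod L,
      triangleOp (J / 2) (J / 2) (mgDim L c i).1 (mgDim L c i).2 (mgApex L c i) =
        ((J / 2 : ℝ) : ℂ) • (spinDot 1 i (i + 1) + spinDot 1 i (i + 2) + spinDot 1 (i + 1) (i + 2) :
          Op (ZMod L) 2) := by
    intro i
    unfold mgDim mgApex triangleOp
    split_ifs with h
    · dsimp only
      module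
    · dsimp only
      rw [spinDot_comm 1 i (i + 1), spinDot_comm 1 i (i + 2)]
      module
  rw [triangleSum, Finset.sum_congr rfl fun i _ => hterm i, ← Finset.smul_sum,
    Finset.sum_add_distrib, Finset.sum_add_distrib]
  have hshift : ∑ i : ZMod L, (spinDot 1 (i + 1) (i + 2) : Op (ZMod L) 2) =
      ∑ i : ZMod L, (spinDot 1 i (i + 1) : Op (ZMod L) 2) := by
    have e : ∀ i : ZMod L, i + 2 = i + 1 + 1 := fun i => by ring
    simp_rw [e]
    exact Fintype.sum_equiv (Equiv.addRight 1) _ _ fun i => rfl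
  rw [hshift, mgHamiltonian, Finset.sum_add_distrib, ← Finset.smul_sum, ← Finset.smul_sum]
  push_cast
  module

/-- **Majumdar–Ghosh theorem.** On the ring `ℤ/Lℤ` with `L` even, `L ≥ 4`, and `J ≥ 0`, each of
the two dimer states `|d⟩_± = ∏ (↑_{i}↓_{i+1} - ↓_{i}↑_{i+1})` over `i ≡ c (mod 2)` is a ground
state of `H = J Σ_i (𝐒_i·𝐒_{i+1} + ½ 𝐒_i·𝐒_{i+2})`, and the ground-state energy is
`E₀ = -3JL/8` (`-¾J` per dimer: the next-nearest bonds and the inter-dimer bonds do not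
contribute). Majumdar–Ghosh (1969); Auerbach (1994) §8.2.1, eqs. (8.11)–(8.16)
("`H^{MG}|d⟩_± = 0` and all other eigenenergies are positive" for the shifted `H^{MG}`). The size
of the ground-state degeneracy is not asserted. [cite: Auerbach1994, §8.2.1 eqs. (8.11)–(8.16)] -/
theorem majumdarGhosh_isGroundStateVector (h2 : 2 ∣ L) (hL : 4 ≤ L) {J : ℝ} (hJ : 0 ≤ J)
    (c : ZMod 2) :
    (mgHamiltonian L J).IsGroundStateVector (dimerState (mgDimers L c)) ∧
      (mgHamiltonian L J).groundEnergy = -(3 * J / 8 * L) := by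
  haveI : Nonempty (ZMod L) := ⟨0⟩
  have h := triangleSum_isGroundStateVector (T := Finset.univ) (a := fun _ => J / 2)
    (b := fun _ => J / 2) (isDimerSet_mgDimers h2 c) (fun i _ => mgDim_mem h2 c i)
    (fun i _ => mgApex_ne h2 (by omega) c i) (fun _ _ => ⟨by linarith, le_rfl⟩)
  rw [mg_triangleSum_eq] at h
  refine ⟨h.1, ?_⟩
  rw [h.2, Finset.sum_const, Finset.card_univ, ZMod.card, nsmul_eq_mul]
  ring

/-- The Majumdar–Ghosh ground-state energy per site is `-3J/8`. [cite: Auerbach1994, §8.2.1] -/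
theorem majumdarGhosh_groundEnergy_div (h2 : 2 ∣ L) (hL : 4 ≤ L) {J : ℝ} (hJ : 0 ≤ J) :
    (mgHamiltonian L J).groundEnergy / L = -(3 * J / 8) := by
  rw [(majumdarGhosh_isGroundStateVector h2 hL hJ 0).2]
  have hL0 : (L : ℝ) ≠ 0 := by exact_mod_cast NeZero.ne L
  field_simp

end MajumdarGhosh

/-! ## §5 The Shastry–Sutherland lattice -/

section ShastrySutherland

open Literature.Probability.LatticeModels

variable (L : ℕ) [NeZero L]

/-- The parity `x_i mod 2` of a coordinate of a site of the even torus `(ℤ/Lℤ)²`.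
[cite: MiyaharaUeda1999, Fig. 1] -/
def ssParity (x : TorusSite 2 L) (i : Fin 2) : ZMod 2 := (ZMod.cast (x i) : ZMod 2)

/-- The **base points of the dimer plaquettes**: the sites `x = (x₀, x₁)` with `x₀ ≡ x₁ (mod 2)`
(the lower-left corners of every second plaquette, in a checkerboard fashion); each carries one
diagonal dimer. [cite: MiyaharaUeda1999, Fig. 1] -/
def ssBlack : Finset (TorusSite 2 L) :=
  Finset.univ.filter fun x => ssParity L x 0 = ssParity L x 1

/-- The **dimer of the plaquette at a base point** `x`: the main diagonal `(x, x+e₀+e₁)` when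
`x ≡ (0,0)`, the anti-diagonal `(x+e₀, x+e₁)` when `x ≡ (1,1) (mod 2)` — the orthogonal-dimer
(Shastry–Sutherland) pattern, under which every site lies on exactly one dimer.
[cite: MiyaharaUeda1999, Fig. 1] -/
def ssDimer (x : TorusSite 2 L) : TorusSite 2 L × TorusSite 2 L :=
  if ssParity L x 0 = 0 then (x, x + Pi.single 0 1 + Pi.single 1 1)
  else (x + Pi.single 0 1, x + Pi.single 1 1)

/-- The two **apexes** of the dimer plaquette at `x`: its two corners off the dimer (each is joined
to both ends of the dimer by square-lattice bonds, forming Shastry–Sutherland's two triangles).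
[cite: ShastrySutherland1981] -/
def ssApex (q : TorusSite 2 L × Fin 2) : TorusSite 2 L :=
  if ssParity L q.1 0 = 0 then ![q.1 + Pi.single 0 1, q.1 + Pi.single 1 1] q.2
  else ![q.1, q.1 + Pi.single 0 1 + Pi.single 1 1] q.2

/-- The Shastry–Sutherland **dimer covering** of the even torus. [cite: MiyaharaUeda1999, eq. (3)] -/
def ssDimers : Finset (TorusSite 2 L × TorusSite 2 L) := (ssBlack L).image (ssDimer L)

/-- The four square-lattice bonds of the plaquette with lower-left corner `x`.
[cite: MiyaharaUeda1999, eq. (1)] -/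
def ssPlaquette (x : TorusSite 2 L) : Op (TorusSite 2 L) 2 :=
  spinDot 1 x (x + Pi.single 0 1) + spinDot 1 x (x + Pi.single 1 1) +
    spinDot 1 (x + Pi.single 1 1) (x + Pi.single 1 1 + Pi.single 0 1) +
    spinDot 1 (x + Pi.single 0 1) (x + Pi.single 0 1 + Pi.single 1 1)

/-- The **Shastry–Sutherland Hamiltonian** on the torus `(ℤ/Lℤ)²` (spin ½):
`H = J' Σ_x Σ_i 𝐒_x·𝐒_{x+eᵢ} + J Σ_{dimers (x,y)} 𝐒_x·𝐒_y` — all square-lattice bonds with coupling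
`J'` and the orthogonally staggered diagonal dimer bonds with coupling `J` (Miyahara–Ueda's
notation has the roles of "nearest" (`J`, dimer) and "next-nearest" (`J'`, square lattice)
neighbours as in SrCu₂(BO₃)₂). [cite: MiyaharaUeda1999, eq. (1)] -/
def ssHamiltonian (J J' : ℝ) : Op (TorusSite 2 L) 2 :=
  (J' : ℂ) • (∑ x : TorusSite 2 L, ∑ i : Fin 2, spinDot 1 x (x + Pi.single i 1)) +
    (J : ℂ) • ∑ x ∈ ssBlack L, spinDot 1 (ssDimer L x).1 (ssDimer L x).2

/-- The base point of the dimer through a site `x`, read off from the parities of `x`: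
`(0,0) ↦ x`, `(1,1) ↦ x-e₀-e₁`, `(1,0) ↦ x-e₁`, `(0,1) ↦ x-e₀`. [cite: MiyaharaUeda1999, Fig. 1] -/
def ssBase (x : TorusSite 2 L) : TorusSite 2 L :=
  if ssParity L x 0 = 0 then (if ssParity L x 1 = 0 then x else x - Pi.single 0 1)
  else (if ssParity L x 1 = 0 then x - Pi.single 1 1 else x - Pi.single 0 1 - Pi.single 1 1)

variable {L}

/-! ### Parity bookkeeping on the even torus -/

omit [NeZero L] in
/-- Coordinate parities are additive on the even torus. [folklore] -/
private theorem ssParity_add (h2 : 2 ∣ L) (x y : TorusSite 2 L) (i : Fin 2) :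
    ssParity L (x + y) i = ssParity L x i + ssParity L y i := by
  have h := map_add (ZMod.castHom h2 (ZMod 2)) (x i) (y i)
  simpa [ssParity] using h

omit [NeZero L] in
/-- Coordinate parities are subtractive on the even torus. [folklore] -/
private theorem ssParity_sub (h2 : 2 ∣ L) (x y : TorusSite 2 L) (i : Fin 2) :
    ssParity L (x - y) i = ssParity L x i - ssParity L y i := by
  have h := map_sub (ZMod.castHom h2 (ZMod 2)) (x i) (y i)
  simpa [ssParity] using h

omit [NeZero L] in
/-- The unit vector `eᵢ` has parity `1` in direction `i`. [folklore] -/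
private theorem ssParity_single_same (h2 : 2 ∣ L) (i : Fin 2) :
    ssParity L (Pi.single i 1 : TorusSite 2 L) i = 1 := by
  have h := map_one (ZMod.castHom h2 (ZMod 2))
  simpa [ssParity] using h

omit [NeZero L] in
/-- The unit vector `eᵢ` has parity `0` in the other direction. [folklore] -/
private theorem ssParity_single_ne {i j : Fin 2} (h : j ≠ i) :
    ssParity L (Pi.single i 1 : TorusSite 2 L) j = 0 := by
  simp [ssParity, h]

/-- `1 ≠ 0` in `ℤ/Lℤ` (even `L ≠ 0`), torus version. [folklore] -/
private theorem torus_one_ne_zero (h2 : 2 ∣ L) : (1 : ZMod L) ≠ 0 := one_ne_zero_of_even h2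

omit [NeZero L] in
/-- Sites differing in one coordinate are distinct. [folklore] -/
private theorem ne_of_coord {x y : TorusSite 2 L} (i : Fin 2) (h : x i ≠ y i) : x ≠ y :=
  fun e => h (congrFun e i)

/-- In `ℤ/2ℤ`, `u ≠ 0` forces `u = 1`. [folklore] -/
private theorem zmod2_eq_one_of_ne_zero : ∀ {u : ZMod 2}, u ≠ 0 → u = 1 := by decide

/-- In `ℤ/2ℤ`, `u ≠ v` forces `u = v - 1`. [folklore] -/
private theorem zmod2_eq_sub_one_of_ne : ∀ {u v : ZMod 2}, u ≠ v → u = v - 1 := by decide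

/-- The corners of a plaquette are pairwise distinct (six inequalities). [folklore] -/
private theorem corner_ne (h2 : 2 ∣ L) (x : TorusSite 2 L) :
    x ≠ x + Pi.single 0 1 ∧ x ≠ x + Pi.single 1 1 ∧ x ≠ x + Pi.single 0 1 + Pi.single 1 1 ∧
      x + Pi.single 0 1 ≠ x + Pi.single 1 1 ∧
      x + Pi.single 0 1 ≠ x + Pi.single 0 1 + Pi.single 1 1 ∧
      (x + Pi.single 1 1 : TorusSite 2 L) ≠ x + Pi.single 0 1 + Pi.single 1 1 := by
  have h1 := torus_one_ne_zero h2
  refine ⟨ne_of_coord 0 ?_, ne_of_coord 1 ?_, ne_of_coord 0 ?_, ne_of_coord 0 ?_, ne_of_coord 1 ?_,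
    ne_of_coord 0 ?_⟩ <;> simp [h1]

/-! ### The dimer covering -/

/-- **`ssBase` recovers the base point from either end of its dimer.**
[cite: MiyaharaUeda1999, Fig. 1] -/
theorem ssBase_ssDimer (h2 : 2 ∣ L) {p : TorusSite 2 L} (hp : p ∈ ssBlack L) :
    ssBase L (ssDimer L p).1 = p ∧ ssBase L (ssDimer L p).2 = p := by
  simp only [ssBlack, Finset.mem_filter, Finset.mem_univ, true_and] at hp
  have h10 : (1 : Fin 2) ≠ 0 := by decide
  have h01 : (0 : Fin 2) ≠ 1 := by decide
  have e11 : (1 : ZMod 2) + 1 = 0 := by decide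
  have n10 : (1 : ZMod 2) ≠ 0 := by decide
  by_cases h : ssParity L p 0 = 0
  · -- even-even plaquette: dimer `(p, p + e₀ + e₁)`
    have h1' : ssParity L p 1 = 0 := hp ▸ h
    have q0 : ssParity L (p + Pi.single 0 1 + Pi.single 1 1) 0 = 1 := by
      rw [ssParity_add h2, ssParity_add h2, h, ssParity_single_same h2, ssParity_single_ne h01]
      decide
    have q1 : ssParity L (p + Pi.single 0 1 + Pi.single 1 1) 1 = 1 := by
      rw [ssParity_add h2, ssParity_add h2, h1', ssParity_single_ne h10, ssParity_single_same h2]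
      decide
    rw [ssDimer, if_pos h]
    constructor
    · rw [ssBase, if_pos h, if_pos h1']
    · rw [ssBase, if_neg (by rw [q0]; exact n10), if_neg (by rw [q1]; exact n10), sub_sub, add_assoc]
      exact add_sub_cancel_right _ _
  · -- odd-odd plaquette: dimer `(p + e₀, p + e₁)`
    have h0 : ssParity L p 0 = 1 := zmod2_eq_one_of_ne_zero h
    have h1' : ssParity L p 1 = 1 := hp ▸ h0
    have q00 : ssParity L (p + Pi.single 0 1) 0 = 0 := by
      rw [ssParity_add h2, h0, ssParity_single_same h2, e11]
    have q01 : ssParity L (p + Pi.single 0 1) 1 = 1 := by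
      rw [ssParity_add h2, h1', ssParity_single_ne h10, add_zero]
    have q10 : ssParity L (p + Pi.single 1 1) 0 = 1 := by
      rw [ssParity_add h2, h0, ssParity_single_ne h01, add_zero]
    have q11 : ssParity L (p + Pi.single 1 1) 1 = 0 := by
      rw [ssParity_add h2, h1', ssParity_single_same h2, e11]
    rw [ssDimer, if_neg h]
    constructor
    · rw [ssBase, if_pos q00, if_neg (by rw [q01]; exact n10)]
      exact add_sub_cancel_right _ _
    · rw [ssBase, if_neg (by rw [q10]; exact n10), if_pos q11]
      exact add_sub_cancel_right _ _

/-- **The Shastry–Sutherland dimers form a dimer set** (a perfect matching of the even torus: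
distinct base points give disjoint dimers). [cite: MiyaharaUeda1999, eq. (3)] -/
theorem isDimerSet_ssDimers (h2 : 2 ∣ L) : IsDimerSet (ssDimers L) := by
  constructor
  · intro d hd
    obtain ⟨p, -, rfl⟩ := Finset.mem_image.mp hd
    obtain ⟨-, -, n03, n12, -, -⟩ := corner_ne h2 p
    unfold ssDimer
    split_ifs
    · exact n03
    · exact n12
  · intro d hd d' hd' hne
    obtain ⟨p, hp, rfl⟩ := Finset.mem_image.mp hd
    obtain ⟨p', hp', rfl⟩ := Finset.mem_image.mp hd'
    have hpp : p ≠ p' := fun h => hne (by rw [h])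
    obtain ⟨b1, b2⟩ := ssBase_ssDimer h2 hp
    obtain ⟨b1', b2'⟩ := ssBase_ssDimer h2 hp'
    refine ⟨fun h => hpp ?_, fun h => hpp ?_, fun h => hpp ?_, fun h => hpp ?_⟩
    · rw [← b1, h, b1']
    · rw [← b1, h, b2']
    · rw [← b2, h, b1']
    · rw [← b2, h, b2']

/-- The apexes of a dimer plaquette are off its dimer. [cite: ShastrySutherland1981] -/
theorem ssApex_ne (h2 : 2 ∣ L) (q : TorusSite 2 L × Fin 2) :
    ssApex L q ≠ (ssDimer L q.1).1 ∧ ssApex L q ≠ (ssDimer L q.1).2 := by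
  obtain ⟨x, j⟩ := q
  obtain ⟨n01, n02, n03, n12, n13, n23⟩ := corner_ne h2 x
  unfold ssApex ssDimer
  dsimp only
  split_ifs with h <;> fin_cases j <;>
    simp only [Fin.zero_eta, Fin.mk_one, Fin.isValue, Matrix.cons_val_zero, Matrix.cons_val_one]
  · exact ⟨n01.symm, n13⟩
  · exact ⟨n02.symm, n23⟩
  · exact ⟨n01, n02⟩
  · exact ⟨n13.symm, n23.symm⟩

/-! ### The triangle decomposition of the Shastry–Sutherland Hamiltonian -/

/-- **One dimer plaquette = two triangles**: the dimer bond `J` (half in each triangle) and the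
four square-lattice bonds `J'` of its plaquette. [cite: ShastrySutherland1981] -/
theorem ss_trianglePair_eq (x : TorusSite 2 L) (J J' : ℝ) :
    ∑ j : Fin 2, triangleOp (J / 2) J' (ssDimer L x).1 (ssDimer L x).2 (ssApex L (x, j)) =
      (J : ℂ) • spinDot 1 (ssDimer L x).1 (ssDimer L x).2 + (J' : ℂ) • ssPlaquette L x := by
  have e : x + Pi.single 1 1 + Pi.single 0 1 = (x + Pi.single 0 1 + Pi.single 1 1 : TorusSite 2 L) :=
    add_right_comm _ _ _
  rw [Fin.sum_univ_two]
  unfold ssDimer ssApex triangleOp ssPlaquette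
  dsimp only
  rw [e]
  split_ifs with h <;>
    simp only [Fin.isValue, Matrix.cons_val_zero, Matrix.cons_val_one]
  · rw [spinDot_comm 1 (x + Pi.single 0 1) (x + Pi.single 0 1 + Pi.single 1 1),
      spinDot_comm 1 (x + Pi.single 1 1) (x + Pi.single 0 1 + Pi.single 1 1)]
    push_cast
    module
  · rw [spinDot_comm 1 x (x + Pi.single 0 1), spinDot_comm 1 x (x + Pi.single 1 1)]
    push_cast
    module

/-- **Every square-lattice bond lies in exactly one dimer plaquette**: the sum of the plaquette
operators over the base points is the full nearest-neighbour sum `Σ_x Σ_i 𝐒_x·𝐒_{x+eᵢ}` of the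
torus (the bonds starting at a non-base point `x` are the top / right bonds of the plaquettes at
`x - e₁` / `x - e₀`). [cite: MiyaharaUeda1999, eq. (1) and Fig. 1] -/
theorem sum_ssPlaquette_eq (h2 : 2 ∣ L) :
    ∑ x ∈ ssBlack L, ssPlaquette L x =
      ∑ x : TorusSite 2 L, ∑ i : Fin 2, (spinDot 1 x (x + Pi.single i 1) : Op (TorusSite 2 L) 2) := by
  have h10 : (1 : Fin 2) ≠ 0 := by decide
  have h01 : (0 : Fin 2) ≠ 1 := by decide
  -- membership tests
  have black_iff : ∀ x : TorusSite 2 L, x ∈ ssBlack L ↔ ssParity L x 0 = ssParity L x 1 := fun x => by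
    simp [ssBlack]
  have white_iff : ∀ x : TorusSite 2 L,
      x ∈ Finset.univ.filter (fun x => ¬ ssParity L x 0 = ssParity L x 1) ↔
        ssParity L x 0 ≠ ssParity L x 1 := fun x => by simp
  -- the bonds `(x, x + e₀)` from white `x` are the top bonds of the plaquettes at `x - e₁`
  have hW0 : ∑ x ∈ Finset.univ.filter (fun x => ¬ ssParity L x 0 = ssParity L x 1),
      (spinDot 1 x (x + Pi.single 0 1) : Op (TorusSite 2 L) 2) =
      ∑ p ∈ ssBlack L, spinDot 1 (p + Pi.single 1 1) (p + Pi.single 1 1 + Pi.single 0 1) := by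
    symm
    refine Finset.sum_nbij' (fun p => p + Pi.single 1 1) (fun x => x - Pi.single 1 1) ?_ ?_ ?_ ?_ ?_
    · intro p hp
      rw [black_iff] at hp
      rw [white_iff, ssParity_add h2, ssParity_add h2, ssParity_single_ne h01,
        ssParity_single_same h2, add_zero, hp]
      exact (zmod2_add_one_ne _).symm
    · intro x hx
      rw [white_iff] at hx
      rw [black_iff, ssParity_sub h2, ssParity_sub h2, ssParity_single_ne h01,
        ssParity_single_same h2, sub_zero]
      exact zmod2_eq_sub_one_of_ne hx
    · intro p _; exact add_sub_cancel_right _ _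
    · intro x _; exact sub_add_cancel _ _
    · intro p _; rfl
  -- the bonds `(x, x + e₁)` from white `x` are the right bonds of the plaquettes at `x - e₀`
  have hW1 : ∑ x ∈ Finset.univ.filter (fun x => ¬ ssParity L x 0 = ssParity L x 1),
      (spinDot 1 x (x + Pi.single 1 1) : Op (TorusSite 2 L) 2) =
      ∑ p ∈ ssBlack L, spinDot 1 (p + Pi.single 0 1) (p + Pi.single 0 1 + Pi.single 1 1) := by
    symm
    refine Finset.sum_nbij' (fun p => p + Pi.single 0 1) (fun x => x - Pi.single 0 1) ?_ ?_ ?_ ?_ ?_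
    · intro p hp
      rw [black_iff] at hp
      rw [white_iff, ssParity_add h2, ssParity_add h2, ssParity_single_same h2,
        ssParity_single_ne h10, add_zero, hp]
      exact zmod2_add_one_ne _
    · intro x hx
      rw [white_iff] at hx
      rw [black_iff, ssParity_sub h2, ssParity_sub h2, ssParity_single_same h2,
        ssParity_single_ne h10, sub_zero]
      exact (zmod2_eq_sub_one_of_ne (Ne.symm hx)).symm
    · intro p _; exact add_sub_cancel_right _ _
    · intro x _; exact sub_add_cancel _ _
    · intro p _; rfl
  calc ∑ x ∈ ssBlack L, ssPlaquette L x
      = ∑ x ∈ ssBlack L, ((spinDot 1 x (x + Pi.single 0 1) : Op (TorusSite 2 L) 2) +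
          spinDot 1 x (x + Pi.single 1 1)) +
        (∑ p ∈ ssBlack L, (spinDot 1 (p + Pi.single 1 1) (p + Pi.single 1 1 + Pi.single 0 1) :
            Op (TorusSite 2 L) 2) +
          ∑ p ∈ ssBlack L, spinDot 1 (p + Pi.single 0 1) (p + Pi.single 0 1 + Pi.single 1 1)) := by
        simp only [ssPlaquette, Finset.sum_add_distrib]
        abel
    _ = ∑ x ∈ ssBlack L, ((spinDot 1 x (x + Pi.single 0 1) : Op (TorusSite 2 L) 2) +
          spinDot 1 x (x + Pi.single 1 1)) +
        ∑ x ∈ Finset.univ.filter (fun x => ¬ ssParity L x 0 = ssParity L x 1),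
          ((spinDot 1 x (x + Pi.single 0 1) : Op (TorusSite 2 L) 2) +
            spinDot 1 x (x + Pi.single 1 1)) := by
        rw [Finset.sum_add_distrib (s := Finset.univ.filter _), hW0, hW1]
    _ = ∑ x : TorusSite 2 L, ((spinDot 1 x (x + Pi.single 0 1) : Op (TorusSite 2 L) 2) +
          spinDot 1 x (x + Pi.single 1 1)) := by
        rw [ssBlack]
        exact Finset.sum_filter_add_sum_filter_not _ _ _
    _ = ∑ x : TorusSite 2 L, ∑ i : Fin 2, (spinDot 1 x (x + Pi.single i 1) : Op (TorusSite 2 L) 2) :=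
        Finset.sum_congr rfl fun x _ => by rw [Fin.sum_univ_two]

/-- **The Shastry–Sutherland Hamiltonian is a triangle sum** over (dimer plaquette, apex) pairs,
with strong bond `½J` (the dimer, shared by its two triangles) and weak bonds `J'`.
[cite: ShastrySutherland1981] -/
theorem ss_triangleSum_eq (h2 : 2 ∣ L) (J J' : ℝ) :
    triangleSum (ssBlack L ×ˢ (Finset.univ : Finset (Fin 2))) (fun q => ssDimer L q.1) (ssApex L)
        (fun _ => J / 2) (fun _ => J') = ssHamiltonian L J J' := by
  rw [triangleSum, Finset.sum_product]
  dsimp only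
  rw [Finset.sum_congr rfl fun x _ => ss_trianglePair_eq x J J', Finset.sum_add_distrib,
    ← Finset.smul_sum, ← Finset.smul_sum, sum_ssPlaquette_eq h2, ssHamiltonian, add_comm]

/-- **Half of the sites are base points**: `2 · #(base points) = L²` (translation by `e₀`
exchanges base points and non-base points). [cite: MiyaharaUeda1999, Fig. 1] -/
theorem two_mul_card_ssBlack (h2 : 2 ∣ L) : 2 * (ssBlack L).card = L ^ 2 := by
  have h10 : (1 : Fin 2) ≠ 0 := by decide
  have hcard : (ssBlack L).card =
      (Finset.univ.filter (fun x : TorusSite 2 L => ¬ ssParity L x 0 = ssParity L x 1)).card := by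
    refine Finset.card_nbij' (fun p => p + Pi.single 0 1) (fun x => x - Pi.single 0 1) ?_ ?_ ?_ ?_
    · intro p hp
      simp only [Finset.mem_coe, ssBlack, Finset.mem_filter, Finset.mem_univ, true_and] at hp ⊢
      rw [ssParity_add h2, ssParity_add h2, ssParity_single_same h2, ssParity_single_ne h10,
        add_zero, hp]
      exact zmod2_add_one_ne _
    · intro x hx
      simp only [Finset.mem_coe, ssBlack, Finset.mem_filter, Finset.mem_univ, true_and] at hx ⊢
      rw [ssParity_sub h2, ssParity_sub h2, ssParity_single_same h2, ssParity_single_ne h10,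
        sub_zero]
      exact (zmod2_eq_sub_one_of_ne (Ne.symm hx)).symm
    · intro p _; exact add_sub_cancel_right _ _
    · intro x _; exact sub_add_cancel _ _
  have htot := Finset.card_filter_add_card_filter_not
    (s := (Finset.univ : Finset (TorusSite 2 L))) (fun x : TorusSite 2 L => ssParity L x 0 = ssParity L x 1)
  rw [Finset.card_univ, Fintype.card_pi, Finset.prod_const, ZMod.card, Finset.card_univ,
    Fintype.card_fin] at htot
  rw [← ssBlack, ← hcard] at htot
  omega

/-- **Shastry–Sutherland theorem.** On the torus `(ℤ/Lℤ)²` with `L` even and couplings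
`0 ≤ J' ≤ J/2`, the product of singlets on the orthogonally staggered diagonal dimers is a ground
state of `H = J' Σ_⟨xy⟩ 𝐒_x·𝐒_y + J Σ_{dimers} 𝐒_x·𝐒_y`, with ground-state energy `-¾J` per dimer:
`E₀ = -¾J · #dimers`. Every square-lattice bond lies in a triangle with one dimer; each triangle
`½J 𝐒_x·𝐒_y + J'(𝐒_x + 𝐒_y)·𝐒_z` is bounded below by its singlet value `-3J/8` when `J' ≤ J/2`
(`posSemidef_triangleOp_add`), and the dimer state attains all these bounds at once.
Shastry–Sutherland (1981); Oitmaa–Hamer–Zheng (2006) §5.4.2 p. 108 ("an exact eigenstate of `H` for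
all `J, J'` and … the ground state at least for `J/J' > 2`"); Miyahara–Ueda (1999) eqs. (1)–(4).
Uniqueness and the extent of the dimer phase beyond `J'/J = ½` are not asserted.
[cite: OitmaaHamerZheng2006, §5.4.2 p. 108] [cite: ShastrySutherland1981] -/
theorem shastrySutherland_isGroundStateVector (h2 : 2 ∣ L) {J J' : ℝ} (hJ' : 0 ≤ J')
    (hJ : J' ≤ J / 2) :
    (ssHamiltonian L J J').IsGroundStateVector (dimerState (ssDimers L)) ∧
      (ssHamiltonian L J J').groundEnergy = -(3 * J / 4) * (ssBlack L).card := by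
  haveI : Nonempty (TorusSite 2 L) := ⟨fun _ => 0⟩
  have h := triangleSum_isGroundStateVector (T := ssBlack L ×ˢ (Finset.univ : Finset (Fin 2)))
    (dim := fun q => ssDimer L q.1) (apex := ssApex L) (a := fun _ => J / 2) (b := fun _ => J')
    (isDimerSet_ssDimers h2) (fun q hq => Finset.mem_image_of_mem _ (Finset.mem_product.mp hq).1)
    (fun q _ => ssApex_ne h2 q) (fun _ _ => ⟨hJ', hJ⟩)
  rw [ss_triangleSum_eq h2] at h
  refine ⟨h.1, ?_⟩
  rw [h.2, Finset.sum_const, Finset.card_product, Finset.card_univ, Fintype.card_fin, nsmul_eq_mul]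
  push_cast
  ring

/-- **Shastry–Sutherland ground-state energy**: `E₀ = -(3J/8) L²`, i.e. `-3J/8` per site
(`-¾J` per dimer, `L²/2` dimers). [cite: MiyaharaUeda1999, p. 2 ("E_dimer = -(3/8) N J")] -/
theorem shastrySutherland_groundEnergy (h2 : 2 ∣ L) {J J' : ℝ} (hJ' : 0 ≤ J') (hJ : J' ≤ J / 2) :
    (ssHamiltonian L J J').groundEnergy = -(3 * J / 8) * (L : ℝ) ^ 2 := by
  rw [(shastrySutherland_isGroundStateVector h2 hJ' hJ).2]
  have hc : (2 : ℝ) * (ssBlack L).card = (L : ℝ) ^ 2 := by exact_mod_cast two_mul_card_ssBlack h2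
  linear_combination (-(3 * J / 8)) * hc

/-- Dictionary with the tree's torus antiferromagnet (`L ≥ 3`): the `J'` part of the
Shastry–Sutherland Hamiltonian is `heisenbergTorus 2 L 1 J'` (every bond `{x, x+eᵢ}` once), and the
`J` part is the sum over the dimer covering `ssDimers`. [cite: MiyaharaUeda1999, eq. (1)] -/
theorem ssHamiltonian_eq_heisenbergTorus_add (h2 : 2 ∣ L) (hL : 3 ≤ L) (J J' : ℝ) :
    ssHamiltonian L J J' = heisenbergTorus 2 L 1 J' +
      (J : ℂ) • ∑ d ∈ ssDimers L, (spinDot 1 d.1 d.2 : Op (TorusSite 2 L) 2) := by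
  have hH : heisenbergTorus 2 L 1 J' =
      (J' : ℂ) • ∑ x : TorusSite 2 L, ∑ i : Fin 2, (spinDot 1 x (x + Pi.single i 1) :
        Op (TorusSite 2 L) 2) := by
    unfold heisenbergTorus heisenbergHamiltonian
    rw [← sum_pairs_eq_sum_edgeFinset' L hL]
    rfl
  have hinj : Set.InjOn (ssDimer L) (ssBlack L) := by
    intro p hp p' hp' h
    rw [← (ssBase_ssDimer h2 (Finset.mem_coe.mp hp)).1, h, (ssBase_ssDimer h2 (Finset.mem_coe.mp hp')).1]
  rw [ssHamiltonian, hH, ssDimers, Finset.sum_image hinj]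

end ShastrySutherland

/-! ## §6 Complements: the dimer state is an eigenvector for all couplings; the triangle bound in
the regime `a ≤ b`; Anderson-type certified energy floors for the frustrated `J₁–J₂` ring -/

section Complements

/-- **The second triangle inequality** (three distinct spins ½, `0 ≤ a ≤ b`): when the apex bonds
dominate, `a 𝐒_x·𝐒_y + b(𝐒_x·𝐒_z + 𝐒_y·𝐒_z) ⪰ a/4 - b`, because it equals
`½b(𝐉² - ¾) + (b - a)(¼ - 𝐒_x·𝐒_y) + (a/4 - b)` and `𝐒_x·𝐒_y ≤ ¼`
(`posSemidef_quarter_sub_spinDot_one`); the bound is the total-spin-½, bond-triplet level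
`a/4 - b` of the triad (Anderson's cluster method with Auerbach's triads).
[cite: Auerbach1994, §8.2.1 eqs. (8.15)–(8.16)] [cite: Anderson1951, eq. (4)] -/
theorem posSemidef_triangleOp_add_of_le [Nonempty Λ] {a b : ℝ} (ha : 0 ≤ a) (hab : a ≤ b)
    {x y z : Λ} (hxy : x ≠ y) (hxz : x ≠ z) (hyz : y ≠ z) :
    (triangleOp a b x y z + ((b - a / 4 : ℝ) : ℂ) • (1 : Op Λ 2)).PosSemidef := by
  have hz : z ∉ ({x, y} : Finset Λ) := by simp [hxz.symm, hyz.symm]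
  have hcard : ({z, x, y} : Finset Λ).card % 2 = 1 := by
    rw [Finset.card_insert_of_notMem hz, Finset.card_pair hxy]
  have hid : triangleOp a b x y z + ((b - a / 4 : ℝ) : ℂ) • (1 : Op Λ 2) =
      ((b / 2 : ℝ) : ℂ) • ((∑ α : Fin 3, (∑ w ∈ ({z, x, y} : Finset Λ), siteSpin 1 w α) *
          (∑ w ∈ ({z, x, y} : Finset Λ), siteSpin 1 w α) : Op Λ 2) - (3 / 4 : ℂ) • (1 : Op Λ 2)) +
      ((b - a : ℝ) : ℂ) • ((1 / 4 : ℂ) • (1 : Op Λ 2) - spinDot 1 x y) := by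
    rw [setSpinSq_triple hxy hxz hyz, triangleOp]
    push_cast
    module
  rw [hid]
  have hb : (0 : ℝ) ≤ b / 2 := by linarith
  refine PosSemidef.add ?_ ?_
  · exact (posSemidef_setSpinSq_sub_of_odd _ hcard).smul (by exact_mod_cast hb)
  · exact (posSemidef_quarter_sub_spinDot_one hxy).smul
      (by exact_mod_cast (by linarith : (0 : ℝ) ≤ b - a))

/-- A positive-semidefinite shift bounds the ground energy from below: `A + c ⪰ 0 ⇒ -c ≤ E₀(A)`
(evaluate in the tracial ground state; private copy of the tree's `le_groundEnergy_of_posSemidef_sub`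
of `FreeFermiGasNoDWaveOrder.lean`, not imported into this spin file). [folklore] -/
private theorem neg_le_groundEnergy_of_posSemidef_add {m : Type*} [Fintype m] [DecidableEq m]
    [Nonempty m] {A : Matrix m m ℂ} (hA : A.IsHermitian) {c : ℝ}
    (h : (A + (c : ℂ) • (1 : Matrix m m ℂ)).PosSemidef) : -c ≤ A.groundEnergy := by
  have h0 := Matrix.groundStateFunctional_nonneg_of_posSemidef A h
  rw [map_add, LinearMap.map_smul_of_tower, Matrix.groundStateFunctional_hamiltonian hA,
    Matrix.groundStateFunctional_one hA] at h0
  obtain ⟨hre, -⟩ := Complex.nonneg_iff.mp h0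
  simp only [Complex.add_re, Complex.ofReal_re, smul_eq_mul, mul_one] at hre
  linarith

variable (L : ℕ) [NeZero L]

/-- The **frustrated `J₁–J₂` Heisenberg ring** `H = Σ_i (J₁ 𝐒_i·𝐒_{i+1} + J₂ 𝐒_i·𝐒_{i+2})` on
`ℤ/Lℤ` (spin ½); the Majumdar–Ghosh chain is `J₂ = J₁/2` (`mgHamiltonian_eq_j1j2Ring`).
[cite: Auerbach1994, §8.2.1 eq. (8.11)] -/
def j1j2Ring (J₁ J₂ : ℝ) : Op (ZMod L) 2 :=
  ∑ i : ZMod L, ((J₁ : ℂ) • spinDot 1 i (i + 1) + (J₂ : ℂ) • spinDot 1 i (i + 2))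

/-- `H_MG(J) = H_{J, J/2}`. [cite: Auerbach1994, §8.2.1 eq. (8.11)] -/
theorem mgHamiltonian_eq_j1j2Ring (J : ℝ) : mgHamiltonian L J = j1j2Ring L J (J / 2) := rfl

variable {L}

/-- **Triad decomposition of the `J₁–J₂` ring**: `H_{J₁,J₂} = Σ_i [J₂ 𝐒_i·𝐒_{i+2} +
½J₁(𝐒_i·𝐒_{i+1} + 𝐒_{i+2}·𝐒_{i+1})]` — each nearest-neighbour bond lies in two triads
`(i, i+1, i+2)`, each next-nearest bond in one (Auerbach (1994) eq. (8.15); Anderson's covering of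
the lattice by clusters). [cite: Auerbach1994, §8.2.1 eq. (8.15)] -/
theorem j1j2Ring_eq_triangleSum (J₁ J₂ : ℝ) :
    j1j2Ring L J₁ J₂ = triangleSum Finset.univ (fun i : ZMod L => (i, i + 2)) (fun i => i + 1)
      (fun _ => J₂) (fun _ => J₁ / 2) := by
  rw [triangleSum]
  have hterm : ∀ i : ZMod L, triangleOp J₂ (J₁ / 2) (i, i + 2).1 (i, i + 2).2 (i + 1) =
      (J₂ : ℂ) • (spinDot 1 i (i + 2) : Op (ZMod L) 2) +
        ((J₁ / 2 : ℝ) : ℂ) • (spinDot 1 i (i + 1) + spinDot 1 (i + 1) (i + 2)) := by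
    intro i
    rw [triangleOp, spinDot_comm 1 (i + 1) (i + 2)]
  rw [Finset.sum_congr rfl fun i _ => hterm i, Finset.sum_add_distrib, ← Finset.smul_sum,
    ← Finset.smul_sum, Finset.sum_add_distrib]
  have hshift : ∑ i : ZMod L, (spinDot 1 (i + 1) (i + 2) : Op (ZMod L) 2) =
      ∑ i : ZMod L, (spinDot 1 i (i + 1) : Op (ZMod L) 2) := by
    have e : ∀ i : ZMod L, i + 2 = i + 1 + 1 := fun i => by ring
    simp_rw [e]
    exact Fintype.sum_equiv (Equiv.addRight 1) _ _ fun i => rfl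
  rw [hshift, j1j2Ring, Finset.sum_add_distrib, ← Finset.smul_sum, ← Finset.smul_sum]
  push_cast
  module

/-- The `J₁–J₂` ring is Hermitian. [cite: Tasaki2020, §2.4] -/
theorem j1j2Ring_isHermitian (J₁ J₂ : ℝ) : (j1j2Ring L J₁ J₂).IsHermitian := by
  rw [j1j2Ring_eq_triangleSum]
  exact triangleSum_isHermitian

/-- **Certified energy floor for the frustrated ring, `J₂ ≥ J₁/2 ≥ 0`** (`L ≥ 3`): every triad is
bounded below by its singlet value on the strong bond `J₂` (`posSemidef_triangleOp_add`), so
`E₀(H_{J₁,J₂}) ≥ -¾ J₂ L`; sharp at the Majumdar–Ghosh point `J₂ = J₁/2` (`E₀ = -3J₁L/8`).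
Anderson's cluster lower bound with Auerbach's triads. [cite: Anderson1951, eq. (4)]
[cite: Auerbach1994, §8.2.1 eqs. (8.15)–(8.16)] -/
theorem j1j2Ring_groundEnergy_ge_of_le (hL : 3 ≤ L) {J₁ J₂ : ℝ} (hJ₁ : 0 ≤ J₁) (h : J₁ / 2 ≤ J₂) :
    -(3 / 4 * J₂ * L) ≤ (j1j2Ring L J₁ J₂).groundEnergy := by
  haveI : Nonempty (ZMod L) := ⟨0⟩
  have h1 : (1 : ZMod L) ≠ 0 := by
    haveI : Fact (1 < L) := ⟨by omega⟩
    exact one_ne_zero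
  have h2 := two_ne_zero_of_le hL
  have hpsd : (j1j2Ring L J₁ J₂ + ((3 / 4 * J₂ * L : ℝ) : ℂ) • (1 : Op (ZMod L) 2)).PosSemidef := by
    have hsplit : j1j2Ring L J₁ J₂ + ((3 / 4 * J₂ * L : ℝ) : ℂ) • (1 : Op (ZMod L) 2) =
        ∑ i : ZMod L, (triangleOp J₂ (J₁ / 2) i (i + 2) (i + 1) +
          ((3 * J₂ / 4 : ℝ) : ℂ) • (1 : Op (ZMod L) 2)) := by
      rw [Finset.sum_add_distrib, j1j2Ring_eq_triangleSum, triangleSum, Finset.sum_const,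
        Finset.card_univ, ZMod.card, ← Nat.cast_smul_eq_nsmul ℂ, smul_smul]
      push_cast
      ring_nf
    rw [hsplit]
    refine posSemidef_finset_sum _ fun i _ => ?_
    refine posSemidef_triangleOp_add (by linarith) h ?_ ?_ ?_
    · intro e; exact h2 (by simpa using e.symm)
    · intro e; exact h1 (by simpa using e.symm)
    · intro e
      have : i + 2 = i + 1 + 1 := by ring
      rw [this] at e
      exact h1 (by simpa using e)
  exact neg_le_groundEnergy_of_posSemidef_add (j1j2Ring_isHermitian J₁ J₂) hpsd

/-- **Certified energy floor for the frustrated ring, `0 ≤ J₂ ≤ J₁/2`** (`L ≥ 3`): every triad is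
bounded below by its spin-½ bond-triplet value `J₂/4 - J₁/2` (`posSemidef_triangleOp_add_of_le`),
so `E₀(H_{J₁,J₂}) ≥ -(J₁/2 - J₂/4)L`; at `J₂ = 0` this is Anderson's `-½` per bond for the
Heisenberg ring, at `J₂ = J₁/2` it is the exact Majumdar–Ghosh energy `-3J₁L/8`.
[cite: Anderson1951, eq. (4)] [cite: Auerbach1994, §8.2.1 eqs. (8.15)–(8.16)] -/
theorem j1j2Ring_groundEnergy_ge_of_ge (hL : 3 ≤ L) {J₁ J₂ : ℝ} (hJ₂ : 0 ≤ J₂) (h : J₂ ≤ J₁ / 2) :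
    -((J₁ / 2 - J₂ / 4) * L) ≤ (j1j2Ring L J₁ J₂).groundEnergy := by
  haveI : Nonempty (ZMod L) := ⟨0⟩
  have h1 : (1 : ZMod L) ≠ 0 := by
    haveI : Fact (1 < L) := ⟨by omega⟩
    exact one_ne_zero
  have h2 := two_ne_zero_of_le hL
  have hpsd : (j1j2Ring L J₁ J₂ + (((J₁ / 2 - J₂ / 4) * L : ℝ) : ℂ) • (1 : Op (ZMod L) 2)).PosSemidef := by
    have hsplit : j1j2Ring L J₁ J₂ + (((J₁ / 2 - J₂ / 4) * L : ℝ) : ℂ) • (1 : Op (ZMod L) 2) =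
        ∑ i : ZMod L, (triangleOp J₂ (J₁ / 2) i (i + 2) (i + 1) +
          ((J₁ / 2 - J₂ / 4 : ℝ) : ℂ) • (1 : Op (ZMod L) 2)) := by
      rw [Finset.sum_add_distrib, j1j2Ring_eq_triangleSum, triangleSum, Finset.sum_const,
        Finset.card_univ, ZMod.card, ← Nat.cast_smul_eq_nsmul ℂ, smul_smul]
      push_cast
      ring_nf
    rw [hsplit]
    refine posSemidef_finset_sum _ fun i _ => ?_
    refine posSemidef_triangleOp_add_of_le hJ₂ h ?_ ?_ ?_
    · intro e; exact h2 (by simpa using e.symm)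
    · intro e; exact h1 (by simpa using e.symm)
    · intro e
      have : i + 2 = i + 1 + 1 := by ring
      rw [this] at e
      exact h1 (by simpa using e)
  exact neg_le_groundEnergy_of_posSemidef_add (j1j2Ring_isHermitian J₁ J₂) hpsd

/-- **The Majumdar–Ghosh dimer states are eigenvectors for every coupling** `J ∈ ℝ` (no sign
condition; `L` even, `L ≥ 4`): `H_MG(J)|d⟩_± = -(3JL/8)|d⟩_±` (Auerbach (1994) eq. (8.13)).
[cite: Auerbach1994, §8.2.1 eq. (8.13)] -/
theorem mgHamiltonian_mulVec_dimerState (h2 : 2 ∣ L) (hL : 4 ≤ L) (J : ℝ) (c : ZMod 2) :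
    mgHamiltonian L J *ᵥ dimerState (mgDimers L c) =
      ((-(3 * J / 8 * L) : ℝ) : ℂ) • dimerState (mgDimers L c) := by
  have h := triangleSum_mulVec_dimerState (T := Finset.univ) (a := fun _ => J / 2)
    (b := fun _ => J / 2) (isDimerSet_mgDimers h2 c) (fun i _ => mgDim_mem h2 c i)
    (fun i _ => mgApex_ne h2 (by omega) c i)
  rw [mg_triangleSum_eq] at h
  rw [h, Finset.sum_const, Finset.card_univ, ZMod.card, nsmul_eq_mul]
  congr 1
  push_cast
  ring

/-- **The Shastry–Sutherland dimer product is an eigenvector for ALL couplings** `J, J' ∈ ℝ`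
(`L` even): `H ψ_D = -(¾J · #dimers) ψ_D` — "an exact eigenstate of `H` for all `J, J'`"
(Oitmaa–Hamer–Zheng (2006) §5.4.2; Miyahara–Ueda (1999) eqs. (3)–(4); Shastry–Sutherland (1981)).
[cite: OitmaaHamerZheng2006, §5.4.2 p. 108] [cite: MiyaharaUeda1999, eqs. (3)–(4)] -/
theorem ssHamiltonian_mulVec_dimerState (h2 : 2 ∣ L) (J J' : ℝ) :
    ssHamiltonian L J J' *ᵥ dimerState (ssDimers L) =
      ((-(3 * J / 4 * (ssBlack L).card) : ℝ) : ℂ) • dimerState (ssDimers L) := by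
  have h := triangleSum_mulVec_dimerState (T := ssBlack L ×ˢ (Finset.univ : Finset (Fin 2)))
    (dim := fun q => ssDimer L q.1) (apex := ssApex L) (a := fun _ => J / 2) (b := fun _ => J')
    (isDimerSet_ssDimers h2) (fun q hq => Finset.mem_image_of_mem _ (Finset.mem_product.mp hq).1)
    (fun q _ => ssApex_ne h2 q)
  rw [ss_triangleSum_eq h2] at h
  rw [h, Finset.sum_const, Finset.card_product, Finset.card_univ, Fintype.card_fin, nsmul_eq_mul]
  congr 1
  push_cast
  ring

end Complements

end ExactDimer

end Literature.MathematicalPhysics.QuantumLattice
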